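import Literature.Analysis.FluidPDE.NSLerayOseenRepresentation
import Literature.Analysis.FluidPDE.LerayHopfMildForced
import Literature.Analysis.FunctionSpaces.MinkowskiIntegral
import HarnessLib

/-!
# The Oseen representation WITH A FORCE:
# `u(t) = e^{νtΔ}u(0) - B^ν_0(u,u)(t) + ∫₀ᵗ e^{ν(t-τ)Δ} g(τ) dτ` for bounded finite-energy
# duality-form mild solutions driven by a bounded divergence-free force `g`

Analysis/FluidPDE support file (one plumbing definition, everything else proved; no named
facts). It is the FORCED twin of `NSLerayOseenRepresentation.lean`
(`ae_eq_heatExtension_sub_oseenDuhamel_of_isMildNSSolutionOn`: the unforced representation), and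
the common analytic prerequisite of two items of the cell `ns-blowup` (LADDER-NS N1,
route `PalasekTowerBreakdown`): the discharge of Leray's blow-up rate WITH a force
(`lemarieRieusset2016_lerayRate_forced`, Lemarié-Rieusset 2016, Thm. 11.4, whose printed proof runs
in the mild formulation) and the forced short-time sup-norm bound of a bounded classical solution
(the pointwise Duhamel formula, Tao 2013, (7)/(9.2), `u(t) = e^{νtΔ}u₀ + ∫₀ᵗ e^{ν(t-τ)Δ}(-P∇·(u ⊗ u)
+ Pf)(τ) dτ`). The force enters the representation through ONE new term, the heat Duhamel
integral of the (projected, i.e. divergence-free) force: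

* `forceDuhamel ν s g t x = ∫_{τ ∈ (s,t)} (e^{ν(t-τ)Δ} g(τ))(x) dτ` (the definition; a Bochner
  integral in `τ`, pointwise in `x`; the `ν`-version, from a base time `s`, of the tree's
  `heatDuhamel` of `ForcedHeatDuhamelHolder.lean`);
* `norm_forceDuhamel_le` — `‖forceDuhamel ν s g t x‖ ≤ (t - s) G` if `‖g(τ, ·)‖ ≤ G` on `(s, t)`
  (maximum principle of the heat flow, `UnboundedOperators.norm_heatExtension_le`);
* `stronglyMeasurable_forceDuhamelIntegrand`, `aestronglyMeasurable_forceDuhamel` — measurability;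
* `integral_inner_forceDuhamel_eq`, `integral_inner_forceDuhamel_eq_comm` — Fubini: the pairing with
  a continuous compactly supported field is the time integral of the slice pairings, and these are
  moved onto the test field by the symmetry of the caloric pairing
  (`integral_inner_heatExtension_comm_of_bound`): `∫⟪D(t), w⟫ = ∫_{(s,t)} ∫⟪g(τ), e^{ν(t-τ)Δ}w⟫ dτ`
  — for a divergence-free test field `w = φ` this is exactly the FORCE TERM of the tree's duality
  identity `IsMildNSSolutionFrom ν g u₀ u t` (`MildSolution.lean`);
* `isWeaklyDivFree_forceDuhamel` — divergence-free slices give a divergence-free Duhamel term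
  (`IsWeaklyDivFree.heatExtension_of_bound` under the time integral);
* `eLpNorm_two_forceDuhamel_le`, `memLp_two_forceDuhamel` — Minkowski's integral inequality
  (`FunctionSpaces.eLpNorm_integral_le_lintegral_eLpNorm`) and the `L²` contraction of the heat
  flow: `‖D(t)‖₂ ≤ (t - s) G₂` if `‖g(τ)‖₂ ≤ G₂` on `(s, t)`;
* `exists_const_forced_oseenMild_of_bounded` — **the (A1) annihilator step with a force**
  (Koch–Nadirashvili–Seregin–Šverák 2009, Lemma 3.1 / Rem. 3.1, as in the tree's
  `exists_const_oseenMild_of_bounded_isMildNSSolutionOn`): if `u` is bounded and jointly measurable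
  with the duality identities `IsMildNSSolutionOn (Ioc 0 T) ν g (u 0) u` for a jointly measurable
  force `g` with bounded, weakly divergence-free slices on `(0, T)`, then for every `t ∈ (0, T]`
  there is a constant `c` with `u(t) = e^{νtΔ}u(0) - B^ν_0(u,u)(t) + D(t) - c` a.e.;
* `ae_eq_forced_oseenMild_of_bounded` — **the forced Oseen representation**: if moreover the
  slices of `u` and of `g` are square integrable (uniformly for `g`), the constant vanishes
  (all four pieces tend to zero at infinity under the heat flow;
  `UnboundedOperators.tendsto_enorm_heatExtension_atTop`, `exists_norm_heatExtension_oseenDuhamel_le`):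
  `u(t) = e^{νtΔ}u(0) - B^ν_0(u,u)(t) + ∫₀ᵗ e^{ν(t-τ)Δ} g(τ) dτ` a.e., for every `t ∈ (0, T]`
  (Lemarié-Rieusset 2016, Thm. 6.1 with Prop. 6.5: very weak solutions in `L^∞_t L²_x` of the
  system with force are Oseen solutions (6.12) `u = W_{νt} ∗ u₀ + ∫₀ᵗ W_{ν(t-s)} ∗ Pf ds -
  ∫₀ᵗ Σⱼ ∂ⱼ𝒪(ν(t-s)) :: (uⱼu) ds`; Fabes–Jones–Rivière 1972, Thm. 2.1; Tao 2013, (9.2));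
* `IsLerayHopfOn.isMildNSSolutionOn_Ioc_forced` — the forced twin of
  `IsLerayHopfOn.isMildNSSolutionOn_Ioc`: a Leray–Hopf solution of the forced system with `L²` datum,
  `L²_{t,x}` force and uniformly square-integrable slices is a duality-form mild solution on
  `(0, T]` (repackaging of `IsLerayHopfOn.integral_inner_eq_mild_forced`, `LerayHopfMildForced.lean`),
  so that the representation applies to bounded Leray–Hopf (in particular bounded classical
  finite-energy) solutions of the forced system.

Cell `ns-blowup` labels: LABEL Literature port; bears_on LADDER-NS N1
(route-NavierStokesRegularity-PalasekTowerBreakdown, child crux stmt-NavierStokesRegularity-19249 via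
the E–C endpoint cone); WHAT THIS IS NOT: not NS — a representation formula for GIVEN bounded
solutions; nothing about regularity or blow-up is asserted.

## Mathlib / tree search

Tree (`lean search 'heatDuhamel|forceDuhamel|oseenDuhamel_congr|integral_inner_heatExtension_comm'`):
the unforced (A1)/(A) machinery `exists_const_oseenMild_of_bounded_isMildNSSolutionOn`,
`ae_eq_heatExtension_sub_oseenDuhamel_of_isMildNSSolutionOn`, `exists_norm_oseenDuhamel_bounded_le`,
`aestronglyMeasurable_oseenDuhamel`, `isWeaklyDivFree_oseenDuhamel`,
`integral_inner_oseenDuhamel_eq_neg_intervalIntegral`, `exists_stronglyMeasurable_representative`,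
`oseenDuhamel_congr_ae_slices`, `exists_norm_heatExtension_oseenDuhamel_le`
(`NSBoundedMildOseen*`, `NSLerayOseenRepresentation`); the caloric API
`UnboundedOperators.norm_heatExtension_le`, `heatExtension_apply`, `contDiff_heatExtension_holds`,
`eLpNorm_heatExtension_le_holds`, `memLp_heatExtension_holds`, `tendsto_enorm_heatExtension_atTop`,
`heatExtension_const`, `integral_inner_heatExtension_comm_of_bound`,
`IsWeaklyDivFree.heatExtension_of_bound`, `heatExtension_congr_ae`,
`heatExtension_sub_eq_of_memLp` / `heatExtension_add_eq_of_memLp`; the annihilator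
`IsWeaklyDivFree.exists_ae_eq_const_of_norm_le_of_forall_integral_inner_eq_zero`
(`BoundedAnnihilator.lean`); Minkowski `FunctionSpaces.eLpNorm_integral_le_lintegral_eLpNorm`; the
forced duality identity `IsLerayHopfOn.integral_inner_eq_mild_forced`. A `ν = 1` forward heat
Duhamel integral `heatDuhamel` exists (`ForcedHeatDuhamelHolder.lean`, Jia–Šverák localisation) —
the present `forceDuhamel` is its `ν`-version with the measurability proof transplanted
(`stronglyMeasurable_uncurry_heatDuhamelIntegrand`). No forced Oseen representation existed
(`lean search 'forceDuhamel|forced_oseenMild|oseenMild_forced'`: only the pair-form perturbative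
version `exists_const_forced_oseenMild_of_bounded_isMildNSSolutionOn` of `ForcedOseenMildUpToConst`,
for forces `-Σ∇·(aᵢ ⊗ bᵢ)`). Mathlib: `integral_inner`, `integral_integral_swap`,
`norm_setIntegral_le_of_norm_le_const`, `StronglyMeasurable.integral_prod_right`,
`Real.volume_real_Ioo`.

## References

* P. G. Lemarié-Rieusset, *The Navier–Stokes Problem in the 21st Century*, CRC Press (2016),
  Thm. 6.1 with Prop. 6.5 (pp. 133–136: Oseen solutions (6.12) with force), Thm. 11.4 (p. 327).
  [LemarieRieusset2016]
* E. B. Fabes, B. F. Jones, N. M. Rivière, Arch. Rational Mech. Anal. 45 (1972), Thm. 2.1.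
  [FabesJonesRiviere1972]
* G. Koch, N. Nadirashvili, G. Seregin, V. Šverák, Acta Math. 203 (2009) = arXiv:0709.3599,
  Lemma 3.1 / Rem. 3.1 (p. 7). [KochNadirashviliSereginSverak2009]
* T. Tao, Anal. PDE 6 (2013) 25–107 = arXiv:1108.1165, (7) p. 3 and (9.2). [Tao2011]
-/

noncomputable section

open MeasureTheory Set Function Filter TopologicalSpace InnerProductSpace Metric
open _root_.Topology
open scoped RealInnerProductSpace NNReal ENNReal

namespace Literature.Analysis.FluidPDE

variable {E : Type*} [NormedAddCommGroup E] [InnerProductSpace ℝ E] [FiniteDimensional ℝ E]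
  [MeasurableSpace E] [BorelSpace E]

/-! ### The heat Duhamel integral of a force -/

section ForceDuhamel

/-- The **heat Duhamel integral of a force** with viscosity `ν` from the base time `s`:
`forceDuhamel ν s g t x = ∫_{τ ∈ (s,t)} (e^{ν(t-τ)Δ} g(τ))(x) dτ`, the mild solution of
`∂ₜw - νΔw = g`, `w(s) = 0` — the force term of the Oseen integral equation
`u = W_{νt} ∗ u₀ + ∫₀ᵗ W_{ν(t-s)} ∗ Pf ds - B(u,u)` (Lemarié-Rieusset 2016, (6.12)) when
`g = Pf` is the projected force. A Bochner integral in `τ` over `(s, t)`, pointwise in `x`; junk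
(`0`) where it diverges; `0` for `t ≤ s`. [cite: LemarieRieusset2016, Thm. 6.1 (6.12)] -/
def forceDuhamel (ν s : ℝ) (g : ℝ → E → E) (t : ℝ) (x : E) : E :=
  ∫ τ in Ioo s t, UnboundedOperators.heatExtension (g τ) (ν * (t - τ)) x

variable {ν s t T G : ℝ} {g : ℝ → E → E}

/-- Unfolding `forceDuhamel`. [cite: LemarieRieusset2016, Thm. 6.1 (6.12)] -/
theorem forceDuhamel_apply (ν s : ℝ) (g : ℝ → E → E) (t : ℝ) (x : E) :
    forceDuhamel ν s g t x = ∫ τ in Ioo s t, UnboundedOperators.heatExtension (g τ) (ν * (t - τ)) x :=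
  rfl

/-- The slices of the integrand are bounded by the bound of the force (maximum principle for the
heat flow). [cite: LemarieRieusset2016, Thm. 6.1 with Prop. 6.5 (pp. 133–136)] -/
theorem norm_heatExtension_force_le (hν : 0 < ν) (hG : ∀ τ ∈ Ioo s t, ∀ y, ‖g τ y‖ ≤ G)
    {τ : ℝ} (hτ : τ ∈ Ioo s t) (x : E) :
    ‖UnboundedOperators.heatExtension (g τ) (ν * (t - τ)) x‖ ≤ G :=
  UnboundedOperators.norm_heatExtension_le (hG τ hτ) (mul_pos hν (sub_pos.2 hτ.2)) x

/-- **The heat Duhamel integral of a bounded force is bounded**: `‖forceDuhamel ν s g t x‖ ≤ (t - s) G`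
if `‖g(τ, ·)‖ ≤ G` on `(s, t)` (`s ≤ t`, `0 < ν`). [cite: LemarieRieusset2016, Thm. 6.1 with Prop. 6.5 (pp. 133–136)] -/
theorem norm_forceDuhamel_le (hν : 0 < ν) (hst : s ≤ t) (hG : ∀ τ ∈ Ioo s t, ∀ y, ‖g τ y‖ ≤ G)
    (x : E) : ‖forceDuhamel ν s g t x‖ ≤ (t - s) * G := by
  rw [forceDuhamel_apply]
  have h := norm_setIntegral_le_of_norm_le_const (μ := (volume : Measure ℝ)) (s := Ioo s t)
    (f := fun τ => UnboundedOperators.heatExtension (g τ) (ν * (t - τ)) x) measure_Ioo_lt_top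
    (fun τ hτ => norm_heatExtension_force_le hν hG hτ x)
  rw [Real.volume_real_Ioo, max_eq_left (sub_nonneg.2 hst)] at h
  linarith [h]

omit [FiniteDimensional ℝ E] in
/-- Measurability of the Gauss–Weierstrass kernel as a function of `(t, y)` (as in
`ForcedHeatDuhamelHolder.measurable_uncurry_heatKernel`, not imported here). [folklore] -/
private theorem measurable_uncurry_heatKernel' :
    Measurable fun q : ℝ × E => UnboundedOperators.heatKernel q.1 q.2 := by
  unfold UnboundedOperators.heatKernel
  fun_prop

/-- **Joint measurability of the Duhamel integrand** `(τ, x) ↦ (e^{ν(t-τ)Δ} g(τ))(x)` for a jointly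
strongly measurable force (Fubini measurability of the convolution integral; transplant of
`stronglyMeasurable_uncurry_heatDuhamelIntegrand`). [cite: LemarieRieusset2016, Thm. 6.1 with Prop. 6.5 (pp. 133–136)] -/
theorem stronglyMeasurable_forceDuhamelIntegrand (hgm : StronglyMeasurable (uncurry g)) (ν t : ℝ) :
    StronglyMeasurable fun q : ℝ × E => UnboundedOperators.heatExtension (g q.1) (ν * (t - q.1)) q.2 := by
  have hint : StronglyMeasurable
      (uncurry fun (q : ℝ × E) (y : E) =>
        UnboundedOperators.heatKernel (ν * (t - q.1)) y • g q.1 (q.2 - y)) := by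
    have hK : Measurable fun r : (ℝ × E) × E => UnboundedOperators.heatKernel (ν * (t - r.1.1)) r.2 :=
      measurable_uncurry_heatKernel'.comp
        (((measurable_const.sub measurable_fst.fst).const_mul ν).prodMk measurable_snd)
    have hG : StronglyMeasurable fun r : (ℝ × E) × E => g r.1.1 (r.1.2 - r.2) :=
      hgm.comp_measurable (measurable_fst.fst.prodMk (measurable_fst.snd.sub measurable_snd))
    exact hK.stronglyMeasurable.smul hG
  have h1 := hint.integral_prod_right' (ν := (volume : Measure E))
  have heq : (fun q : ℝ × E => UnboundedOperators.heatExtension (g q.1) (ν * (t - q.1)) q.2) =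
      fun q : ℝ × E => ∫ y, UnboundedOperators.heatKernel (ν * (t - q.1)) y • g q.1 (q.2 - y) := by
    funext q; rw [UnboundedOperators.heatExtension_apply]
  rw [heq]; exact h1

/-- The `x`-slices `τ ↦ (e^{ν(t-τ)Δ} g(τ))(x)` of the integrand are strongly measurable. [cite: LemarieRieusset2016, Thm. 6.1 with Prop. 6.5 (pp. 133–136)] -/
theorem stronglyMeasurable_forceDuhamelIntegrand_slice (hgm : StronglyMeasurable (uncurry g))
    (ν t : ℝ) (x : E) :
    StronglyMeasurable fun τ : ℝ => UnboundedOperators.heatExtension (g τ) (ν * (t - τ)) x := by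
  have h := (stronglyMeasurable_forceDuhamelIntegrand hgm ν t).comp_measurable
    (measurable_id.prodMk (measurable_const (a := x)))
  have heq : (fun τ : ℝ => UnboundedOperators.heatExtension (g τ) (ν * (t - τ)) x) =
      (fun q : ℝ × E => UnboundedOperators.heatExtension (g q.1) (ν * (t - q.1)) q.2) ∘
        fun τ : ℝ => (id τ, x) := by
    funext τ
    simp only [Function.comp_apply, id_eq]
  rw [heq]
  exact h

/-- The `x`-slices of the integrand are integrable on `(s, t)` for a bounded force. [cite: LemarieRieusset2016, Thm. 6.1 with Prop. 6.5 (pp. 133–136)] -/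
theorem integrableOn_forceDuhamelIntegrand_slice (hν : 0 < ν) (hgm : StronglyMeasurable (uncurry g))
    (hG : ∀ τ ∈ Ioo s t, ∀ y, ‖g τ y‖ ≤ G) (x : E) :
    IntegrableOn (fun τ : ℝ => UnboundedOperators.heatExtension (g τ) (ν * (t - τ)) x) (Ioo s t)
      volume := by
  refine Measure.integrableOn_of_bounded (M := G) measure_Ioo_lt_top.ne
    (stronglyMeasurable_forceDuhamelIntegrand_slice hgm ν t x).aestronglyMeasurable ?_
  exact (ae_restrict_iff' measurableSet_Ioo).2 (Eventually.of_forall fun τ hτ =>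
    norm_heatExtension_force_le hν hG hτ x)

/-- The integrand with its arguments swapped, `(x, τ) ↦ (e^{ν(t-τ)Δ} g(τ))(x)`, is jointly strongly
measurable (the shape consumed by `StronglyMeasurable.integral_prod_right` and Fubini). [cite: LemarieRieusset2016, Thm. 6.1 with Prop. 6.5 (pp. 133–136)] -/
theorem stronglyMeasurable_forceDuhamelIntegrand_swap (hgm : StronglyMeasurable (uncurry g)) (ν t : ℝ) :
    StronglyMeasurable (uncurry fun (x : E) (τ : ℝ) =>
      UnboundedOperators.heatExtension (g τ) (ν * (t - τ)) x) := by
  have h := (stronglyMeasurable_forceDuhamelIntegrand hgm ν t).comp_measurable measurable_swap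
  have heq : (uncurry fun (x : E) (τ : ℝ) => UnboundedOperators.heatExtension (g τ) (ν * (t - τ)) x) =
      (fun q : ℝ × E => UnboundedOperators.heatExtension (g q.1) (ν * (t - q.1)) q.2) ∘ Prod.swap := by
    funext p
    simp only [uncurry, Function.comp_apply, Prod.fst_swap, Prod.snd_swap]
  rw [heq]
  exact h

/-- **Slices of the heat Duhamel integral of a jointly measurable force are strongly measurable.**
[cite: LemarieRieusset2016, Thm. 6.1 with Prop. 6.5 (pp. 133–136)] -/
theorem aestronglyMeasurable_forceDuhamel (hgm : StronglyMeasurable (uncurry g)) (ν s t : ℝ) :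
    AEStronglyMeasurable (forceDuhamel ν s g t) (volume : Measure E) := by
  have h2 := (stronglyMeasurable_forceDuhamelIntegrand_swap hgm ν t).integral_prod_right
    (ν := (volume : Measure ℝ).restrict (Ioo s t))
  exact h2.aestronglyMeasurable

/-- **Fubini for the pairing of the heat Duhamel integral with a test field**: for `w` continuous
of compact support and a bounded jointly measurable force,
`∫ ⟪forceDuhamel ν s g t, w⟫ = ∫_{(s,t)} ∫ ⟪e^{ν(t-τ)Δ} g(τ), w⟫ dτ`. [cite: LemarieRieusset2016, Thm. 6.1 with Prop. 6.5 (pp. 133–136)] -/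
theorem integral_inner_forceDuhamel_eq (hν : 0 < ν) (hgm : StronglyMeasurable (uncurry g))
    (hG : ∀ τ ∈ Ioo s t, ∀ y, ‖g τ y‖ ≤ G) {w : E → E} (hw : Continuous w)
    (hwc : HasCompactSupport w) :
    ∫ x, ⟪forceDuhamel ν s g t x, w x⟫ =
      ∫ τ in Ioo s t, ∫ x, ⟪UnboundedOperators.heatExtension (g τ) (ν * (t - τ)) x, w x⟫ := by
  haveI : CompleteSpace E := FiniteDimensional.complete ℝ E
  set μ : Measure ℝ := (volume : Measure ℝ).restrict (Ioo s t) with hμ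
  haveI : IsFiniteMeasure μ := ⟨by rw [hμ, Measure.restrict_apply_univ]; exact measure_Ioo_lt_top⟩
  set F : E → ℝ → E := fun x τ => UnboundedOperators.heatExtension (g τ) (ν * (t - τ)) x with hF
  have hFm : StronglyMeasurable (uncurry F) := stronglyMeasurable_forceDuhamelIntegrand_swap hgm ν t
  have hG0 : ∀ᵐ τ ∂μ, ∀ x, ‖F x τ‖ ≤ G := by
    rw [hμ]
    exact (ae_restrict_iff' measurableSet_Ioo).2 (Eventually.of_forall fun τ hτ x =>
      norm_heatExtension_force_le hν hG hτ x)
  -- integrability of the paired integrand on the product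
  have hwi : Integrable w (volume : Measure E) := hw.integrable_of_hasCompactSupport hwc
  have hprod : Integrable (uncurry fun x τ => ⟪F x τ, w x⟫) ((volume : Measure E).prod μ) := by
    have hm : AEStronglyMeasurable (uncurry fun x τ => ⟪F x τ, w x⟫) ((volume : Measure E).prod μ) :=
      hFm.aestronglyMeasurable.inner (hw.aestronglyMeasurable.comp_fst)
    refine ⟨hm, ?_⟩
    rw [hasFiniteIntegral_iff_enorm, lintegral_prod _ hm.enorm]
    have hwi' : ∫⁻ x, ‖w x‖ₑ ∂(volume : Measure E) < ∞ := hwi.2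
    set K : ℝ≥0∞ := ENNReal.ofReal |G| * μ univ with hK
    have hKtop : K ≠ ∞ := ENNReal.mul_ne_top ENNReal.ofReal_ne_top (measure_ne_top μ _)
    calc ∫⁻ x, ∫⁻ τ, ‖uncurry (fun x τ => ⟪F x τ, w x⟫) (x, τ)‖ₑ ∂μ
        ≤ ∫⁻ x, ∫⁻ _τ, ENNReal.ofReal |G| * ‖w x‖ₑ ∂μ := by
          refine lintegral_mono fun x => lintegral_mono_ae ?_
          filter_upwards [hG0] with τ hτ
          simp only [uncurry_apply_pair]
          rw [← ofReal_norm, ← ofReal_norm, ← ENNReal.ofReal_mul (abs_nonneg _)]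
          refine ENNReal.ofReal_le_ofReal ?_
          calc ‖⟪F x τ, w x⟫‖ ≤ ‖F x τ‖ * ‖w x‖ := norm_inner_le_norm _ _
            _ ≤ |G| * ‖w x‖ := by gcongr; exact (hτ x).trans (le_abs_self G)
      _ = ∫⁻ x, K * ‖w x‖ₑ := by
          refine lintegral_congr fun x => ?_
          rw [lintegral_const, hK]
          ring
      _ = K * ∫⁻ x, ‖w x‖ₑ := lintegral_const_mul' _ _ hKtop
      _ < ∞ := ENNReal.mul_lt_top hKtop.lt_top hwi'
  -- the inner product through the time integral, then Fubini
  have hinner : ∀ x, ⟪forceDuhamel ν s g t x, w x⟫ = ∫ τ, ⟪F x τ, w x⟫ ∂μ := by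
    intro x
    have hint : Integrable (F x) μ := by
      rw [hμ]; exact integrableOn_forceDuhamelIntegrand_slice hν hgm hG x
    rw [forceDuhamel_apply, real_inner_comm, ← hμ, ← integral_inner hint (w x)]
    exact integral_congr_ae (Eventually.of_forall fun τ => real_inner_comm _ _)
  calc ∫ x, ⟪forceDuhamel ν s g t x, w x⟫ = ∫ x, ∫ τ, ⟪F x τ, w x⟫ ∂μ :=
        integral_congr_ae (Eventually.of_forall hinner)
    _ = ∫ τ, (∫ x, ⟪F x τ, w x⟫) ∂μ := integral_integral_swap hprod

/-- **The pairing moved onto the test field** (symmetry of the caloric pairing,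
`integral_inner_heatExtension_comm_of_bound`, slice by slice):
`∫ ⟪forceDuhamel ν s g t, w⟫ = ∫_{(s,t)} ∫ ⟪g(τ), e^{ν(t-τ)Δ} w⟫ dτ`. With `w = φ` a divergence-free
test field and `s = 0` this is the force term `∫₀ᵗ ∫ ⟪g τ, heatTest ν φ (t - τ)⟫` of the duality
identity `IsMildNSSolutionFrom ν g u₀ u t`. [cite: LemarieRieusset2016, Thm. 6.1 ((6.12) ⇒ (6.11))] -/
theorem integral_inner_forceDuhamel_eq_comm (hν : 0 < ν) (hgm : StronglyMeasurable (uncurry g))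
    (hG : ∀ τ ∈ Ioo s t, ∀ y, ‖g τ y‖ ≤ G) {w : E → E} (hw : Continuous w)
    (hwc : HasCompactSupport w) :
    ∫ x, ⟪forceDuhamel ν s g t x, w x⟫ =
      ∫ τ in Ioo s t, ∫ x, ⟪g τ x, UnboundedOperators.heatExtension w (ν * (t - τ)) x⟫ := by
  rw [integral_inner_forceDuhamel_eq hν hgm hG hw hwc]
  refine setIntegral_congr_fun measurableSet_Ioo fun τ hτ => ?_
  have hslm : AEStronglyMeasurable (g τ) (volume : Measure E) :=
    (hgm.comp_measurable (measurable_const.prodMk measurable_id)).aestronglyMeasurable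
  exact integral_inner_heatExtension_comm_of_bound hslm (hG τ hτ) hw hwc (mul_pos hν (sub_pos.2 hτ.2))

/-- The force term of the tree's duality identity, in `forceDuhamel` form: for a divergence-free
test field `φ`, `0 < ν` and `s < t`,
`∫ₛᵗ ∫ ⟪g τ, heatTest ν φ (t - τ)⟫ dτ = ∫ ⟪forceDuhamel ν s g t, φ⟫`. [cite: FabesJonesRiviere1972, Thm. 2.1] -/
theorem intervalIntegral_inner_heatTest_eq_integral_inner_forceDuhamel (hν : 0 < ν) (hst : s < t)
    (hgm : StronglyMeasurable (uncurry g)) (hG : ∀ τ ∈ Ioo s t, ∀ y, ‖g τ y‖ ≤ G) {φ : E → E}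
    (hφ : FunctionSpaces.IsTestFunctionOn (⊤ : Opens E) φ) :
    ∫ τ in s..t, ∫ x, ⟪g τ x, heatTest ν φ (t - τ) x⟫ = ∫ x, ⟪forceDuhamel ν s g t x, φ x⟫ := by
  rw [integral_inner_forceDuhamel_eq_comm hν hgm hG hφ.contDiff.continuous hφ.hasCompactSupport,
    intervalIntegral.integral_of_le hst.le, integral_Ioc_eq_integral_Ioo]
  refine setIntegral_congr_fun measurableSet_Ioo fun τ hτ => ?_
  simp only [heatTest_of_pos hν (sub_pos.2 hτ.2)]

/-- **The heat Duhamel integral of a force with weakly divergence-free slices is weakly divergence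
free** (`IsWeaklyDivFree.heatExtension_of_bound` under the time integral). [cite: LemarieRieusset2016, Thm. 6.1 with Prop. 6.5 (pp. 133–136)] -/
theorem isWeaklyDivFree_forceDuhamel (hν : 0 < ν) (hgm : StronglyMeasurable (uncurry g))
    (hG : ∀ τ ∈ Ioo s t, ∀ y, ‖g τ y‖ ≤ G) (hdiv : ∀ τ ∈ Ioo s t, IsWeaklyDivFree (g τ)) :
    IsWeaklyDivFree (forceDuhamel ν s g t) := by
  intro θ hθ
  have hθ1 : ContDiff ℝ 1 θ := hθ.contDiff.of_le (by exact_mod_cast le_top)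
  have hgc : Continuous (gradient θ) := continuous_gradient_of_contDiff hθ1
  have hgs : HasCompactSupport (gradient θ) :=
    (hθ.hasCompactSupport.fderiv (𝕜 := ℝ)).comp_left (g := (InnerProductSpace.toDual ℝ E).symm)
      (map_zero _)
  rw [integral_inner_forceDuhamel_eq hν hgm hG hgc hgs,
    setIntegral_congr_fun measurableSet_Ioo (g := fun _ => (0 : ℝ)) fun τ hτ => ?_]
  · simp
  · have hslm : AEStronglyMeasurable (g τ) (volume : Measure E) :=
      (hgm.comp_measurable (measurable_const.prodMk measurable_id)).aestronglyMeasurable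
    exact (hdiv τ hτ).heatExtension_of_bound hslm (hG τ hτ) (mul_pos hν (sub_pos.2 hτ.2)) θ hθ

/-- **Minkowski for the heat Duhamel integral**: if the slices of the force on `(s, t)` are in `L²`
with `‖g(τ)‖₂ ≤ G₂`, then `‖forceDuhamel ν s g t‖₂ ≤ (t - s) G₂` (Minkowski's integral inequality and the `L²`
contraction of the heat flow; for `t ≤ s` both sides vanish). [cite: LemarieRieusset2016, Thm. 6.1 with Prop. 6.5 (pp. 133–136)] -/
theorem eLpNorm_two_forceDuhamel_le (hν : 0 < ν) (hgm : StronglyMeasurable (uncurry g))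
    {G₂ : ℝ≥0∞} (h2 : ∀ τ ∈ Ioo s t, MemLp (g τ) 2 volume ∧ eLpNorm (g τ) 2 volume ≤ G₂) :
    eLpNorm (forceDuhamel ν s g t) 2 (volume : Measure E) ≤ ENNReal.ofReal (t - s) * G₂ := by
  haveI : CompleteSpace E := FiniteDimensional.complete ℝ E
  set μ : Measure ℝ := (volume : Measure ℝ).restrict (Ioo s t) with hμ
  set F : E → ℝ → E := fun x τ => UnboundedOperators.heatExtension (g τ) (ν * (t - τ)) x with hF
  have hFm : AEStronglyMeasurable (uncurry F) ((volume : Measure E).prod μ) :=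
    (stronglyMeasurable_forceDuhamelIntegrand_swap hgm ν t).aestronglyMeasurable
  have h1 := FunctionSpaces.eLpNorm_integral_le_lintegral_eLpNorm (μ := (volume : Measure E)) (ν := μ)
    hFm (p := 2) one_le_two ENNReal.ofNat_ne_top
  have hD : (fun x => ∫ τ, F x τ ∂μ) = forceDuhamel ν s g t := by
    funext x; rw [forceDuhamel_apply]
  rw [hD] at h1
  refine h1.trans ?_
  calc ∫⁻ τ, eLpNorm (fun x => F x τ) 2 volume ∂μ ≤ ∫⁻ _τ, G₂ ∂μ := by
        rw [hμ]
        refine setLIntegral_mono' measurableSet_Ioo fun τ hτ => ?_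
        have hpos : 0 < ν * (t - τ) := mul_pos hν (sub_pos.2 hτ.2)
        exact (UnboundedOperators.eLpNorm_heatExtension_le_holds (h2 τ hτ).1 one_le_two hpos).trans
          (h2 τ hτ).2
    _ = ENNReal.ofReal (t - s) * G₂ := by
        rw [lintegral_const, hμ, Measure.restrict_apply_univ, Real.volume_Ioo, mul_comm]

/-- **The heat Duhamel integral of a force with uniformly square-integrable slices is in `L²`.** [cite: LemarieRieusset2016, Thm. 6.1 with Prop. 6.5 (pp. 133–136)] -/
theorem memLp_two_forceDuhamel (hν : 0 < ν) (hgm : StronglyMeasurable (uncurry g))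
    {G₂ : ℝ≥0∞} (hG₂ : G₂ ≠ ⊤)
    (h2 : ∀ τ ∈ Ioo s t, MemLp (g τ) 2 volume ∧ eLpNorm (g τ) 2 volume ≤ G₂) :
    MemLp (forceDuhamel ν s g t) 2 (volume : Measure E) :=
  ⟨aestronglyMeasurable_forceDuhamel hgm ν s t,
    (eLpNorm_two_forceDuhamel_le hν hgm h2).trans_lt
      (ENNReal.mul_lt_top ENNReal.ofReal_lt_top hG₂.lt_top)⟩

end ForceDuhamel

/-! ### The forced Oseen representation of bounded duality-form mild solutions -/

section Representation

variable {ν T M G : ℝ} {u g : ℝ → E → E}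

/-- **Bounded duality-form mild solutions WITH A FORCE solve the Oseen integral equation up to a
constant** (the (A1) annihilator step of `exists_const_oseenMild_of_bounded_isMildNSSolutionOn`
run with a force; KNSS 2009, Lemma 3.1 / Rem. 3.1). Let `ν > 0`; let `u` be jointly measurable on
`(0, T) × E` with measurable slices bounded by `M` on `[0, T]` and a weakly divergence-free datum
`u 0`; let the force `g` be jointly strongly measurable with slices bounded by `G` and weakly
divergence free on `(0, T)`; and let `u` satisfy the duality identities from `u 0` on `(0, T]` WITH
the force `g` (`IsMildNSSolutionOn (Ioc 0 T) ν g (u 0) u`). Then for every `t ∈ (0, T]` there is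
`c` with `u(t) = e^{νtΔ}u(0) - B^ν_0(u,u)(t) + ∫₀ᵗ e^{ν(t-τ)Δ}g(τ) dτ - c` a.e. Proof: the bounded
field `z = e^{νtΔ}u(0) - B^ν_0(u,u)(t) + D(t) - u(t)` is weakly divergence free and annihilates
divergence-free test fields (the duality identity at `t`; the force term is `∫⟪D(t), φ⟫` by
`intervalIntegral_inner_heatTest_eq_integral_inner_forceDuhamel`), hence is a.e. constant.
[cite: KochNadirashviliSereginSverak2009, Lemma 3.1 and Rem. 3.1 (arXiv:0709.3599 p. 7)]
[cite: LemarieRieusset2016, Thm. 6.1 with Prop. 6.5 (pp. 133–136)] -/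
theorem exists_const_forced_oseenMild_of_bounded (hν : 0 < ν) (hT : 0 < T)
    (hmild : IsMildNSSolutionOn (Ioc 0 T) ν g (u 0) u)
    (hmeas : AEStronglyMeasurable (uncurry u) ((volume : Measure (ℝ × E)).restrict (Ioo 0 T ×ˢ univ)))
    (hsl : ∀ t ∈ Icc 0 T, AEStronglyMeasurable (u t) volume) (hM : 0 < M)
    (hbd : ∀ t ∈ Icc 0 T, ∀ y, ‖u t y‖ ≤ M) (hdiv0 : IsWeaklyDivFree (u 0))
    (hgm : StronglyMeasurable (uncurry g)) (hG : ∀ τ ∈ Ioo 0 T, ∀ y, ‖g τ y‖ ≤ G)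
    (hgdiv : ∀ τ ∈ Ioo 0 T, IsWeaklyDivFree (g τ))
    {t : ℝ} (ht : t ∈ Ioc 0 T) :
    ∃ c : E, u t =ᵐ[volume] fun x =>
      UnboundedOperators.heatExtension (u 0) (ν * t) x - oseenDuhamel ν 0 u u t x +
        forceDuhamel ν 0 g t x - c := by
  haveI : CompleteSpace E := FiniteDimensional.complete ℝ E
  have h0I : (0 : ℝ) ∈ Icc 0 T := ⟨le_rfl, hT.le⟩
  have htI : t ∈ Icc 0 T := ⟨ht.1.le, ht.2⟩
  have hbd' : ∀ τ ∈ Ioo 0 T, ∀ y, ‖u τ y‖ ≤ M := fun τ hτ y => hbd τ ⟨hτ.1.le, hτ.2.le⟩ y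
  have hG' : ∀ τ ∈ Ioo 0 t, ∀ y, ‖g τ y‖ ≤ G := fun τ hτ y => hG τ ⟨hτ.1, hτ.2.trans_le ht.2⟩ y
  have hgdiv' : ∀ τ ∈ Ioo 0 t, IsWeaklyDivFree (g τ) := fun τ hτ =>
    hgdiv τ ⟨hτ.1, hτ.2.trans_le ht.2⟩
  have hνt : 0 < ν * t := mul_pos hν ht.1
  -- the four bounded pieces
  set h : E → E := UnboundedOperators.heatExtension (u 0) (ν * t) with hh
  set Bt : E → E := oseenDuhamel ν 0 u u t with hBt
  set Dt : E → E := forceDuhamel ν 0 g t with hDt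
  have hu0m : MemLp (u 0) ∞ (volume : Measure E) :=
    memLp_top_of_bound (hsl 0 h0I) M (Eventually.of_forall (hbd 0 h0I))
  have hh_cont : Continuous h :=
    (UnboundedOperators.contDiff_heatExtension_holds hu0m le_top hνt).continuous
  have hh_bd : ∀ x, ‖h x‖ ≤ M := fun x => UnboundedOperators.norm_heatExtension_le (hbd 0 h0I) hνt x
  have hh_m : MemLp h ∞ (volume : Measure E) :=
    memLp_top_of_bound hh_cont.aestronglyMeasurable M (Eventually.of_forall hh_bd)
  obtain ⟨CB, hCB, hCBle⟩ := exists_norm_oseenDuhamel_bounded_le (E := E)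
  have hBt_bd : ∀ x, ‖Bt x‖ ≤ CB * M ^ 2 * ν ^ (-(1 / 2 : ℝ)) * (2 * Real.sqrt (t - 0)) := fun x =>
    hCBle hν ht.1 hM.le (fun τ hτ y => hbd' τ ⟨hτ.1, hτ.2.trans_le ht.2⟩ y)
      (fun τ hτ y => hbd' τ ⟨hτ.1, hτ.2.trans_le ht.2⟩ y) x
  have hBt_meas : AEStronglyMeasurable Bt (volume : Measure E) :=
    aestronglyMeasurable_oseenDuhamel hν hmeas hmeas hM.le hbd' hbd' ht.1 ht.2
  have hBt_m : MemLp Bt ∞ (volume : Measure E) :=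
    memLp_top_of_bound hBt_meas _ (Eventually.of_forall hBt_bd)
  have hDt_bd : ∀ x, ‖Dt x‖ ≤ (t - 0) * G := fun x => norm_forceDuhamel_le hν ht.1.le hG' x
  have hDt_meas : AEStronglyMeasurable Dt (volume : Measure E) :=
    aestronglyMeasurable_forceDuhamel hgm ν 0 t
  have hDt_m : MemLp Dt ∞ (volume : Measure E) :=
    memLp_top_of_bound hDt_meas _ (Eventually.of_forall hDt_bd)
  have hut_m : MemLp (u t) ∞ (volume : Measure E) :=
    memLp_top_of_bound (hsl t htI) M (Eventually.of_forall (hbd t htI))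
  -- the field `z = h - Bt + Dt - u t`
  set z : E → E := fun x => h x - Bt x + Dt x - u t x with hz
  have hz_meas : AEStronglyMeasurable z volume :=
    ((hh_cont.aestronglyMeasurable.sub hBt_meas).add hDt_meas).sub (hsl t htI)
  have hz_bd : ∀ x, ‖z x‖ ≤
      M + CB * M ^ 2 * ν ^ (-(1 / 2 : ℝ)) * (2 * Real.sqrt (t - 0)) + (t - 0) * G + M := by
    intro x
    calc ‖z x‖ ≤ ‖h x - Bt x + Dt x‖ + ‖u t x‖ := norm_sub_le _ _
      _ ≤ (‖h x - Bt x‖ + ‖Dt x‖) + ‖u t x‖ := by gcongr; exact norm_add_le _ _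
      _ ≤ ((‖h x‖ + ‖Bt x‖) + ‖Dt x‖) + ‖u t x‖ := by gcongr; exact norm_sub_le _ _
      _ ≤ ((M + CB * M ^ 2 * ν ^ (-(1 / 2 : ℝ)) * (2 * Real.sqrt (t - 0))) + (t - 0) * G) + M := by
          gcongr
          · exact hh_bd x
          · exact hBt_bd x
          · exact hDt_bd x
          · exact hbd t htI x
  -- weak divergence freeness of `z`
  have hdivh : IsWeaklyDivFree h := hdiv0.heatExtension_of_bound (hsl 0 h0I) (hbd 0 h0I) hνt
  have hdivB : IsWeaklyDivFree Bt :=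
    isWeaklyDivFree_oseenDuhamel hν hmeas hmeas hM.le hbd' hbd' ht.1 ht.2
  have hdivD : IsWeaklyDivFree Dt := isWeaklyDivFree_forceDuhamel hν hgm hG' hgdiv'
  have hdivut : IsWeaklyDivFree (u t) := hmild.1 t ht
  have hz_div : IsWeaklyDivFree z := by
    have h1 : IsWeaklyDivFree (h - Bt) := IsWeaklyDivFree.sub le_top hdivh hdivB hh_m hBt_m
    have h2 : IsWeaklyDivFree (u t - Dt) := IsWeaklyDivFree.sub le_top hdivut hdivD hut_m hDt_m
    have h3 : IsWeaklyDivFree (h - Bt - (u t - Dt)) :=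
      IsWeaklyDivFree.sub le_top h1 h2 (hh_m.sub hBt_m) (hut_m.sub hDt_m)
    have hzeq : z = h - Bt - (u t - Dt) := by
      funext x
      simp only [hz, Pi.sub_apply]
      abel
    rw [hzeq]
    exact h3
  -- `z` annihilates divergence-free test fields: the duality identity at `t`
  have hz_orth : ∀ φ : E → E, FunctionSpaces.IsTestFunctionOn (⊤ : Opens E) φ →
      VectorCalculus.IsDivFree φ → ∫ x, ⟪z x, φ x⟫ = 0 := by
    intro φ hφ hφd
    have hφc := hφ.hasCompactSupport
    have hφcont := hφ.contDiff.continuous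
    have key := hmild.2 t ht φ hφ hφd
    -- the four pairings
    have e1 : ∫ x, ⟪h x, φ x⟫ = ∫ x, ⟪u 0 x, heatTest ν φ t x⟫ := by
      rw [hh, integral_inner_heatExtension_comm_of_bound (hsl 0 h0I) (hbd 0 h0I) hφcont hφc hνt,
        heatTest_of_pos hν ht.1]
    have e2 : ∫ x, ⟪Bt x, φ x⟫ =
        -∫ τ in (0 : ℝ)..t, ∫ y, ⟪u τ y, convect (u τ) (heatTest ν φ (t - τ)) y⟫ :=
      integral_inner_oseenDuhamel_eq_neg_intervalIntegral hν hmeas hM.le hbd' ht.1 ht.2 hφ hφd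
    have e3 : ∫ x, ⟪Dt x, φ x⟫ = ∫ τ in (0 : ℝ)..t, ∫ x, ⟪g τ x, heatTest ν φ (t - τ) x⟫ :=
      (intervalIntegral_inner_heatTest_eq_integral_inner_forceDuhamel hν ht.1 hgm hG' hφ).symm
    -- integrability of the pairings
    have i1 : Integrable (fun x => ⟪h x, φ x⟫) (volume : Measure E) :=
      integrable_inner_of_hasCompactSupport_right hh_cont hφcont hφc
    have i2 : Integrable (fun x => ⟪Bt x, φ x⟫) (volume : Measure E) :=
      integrable_inner_of_aestronglyMeasurable_of_norm_le hBt_meas hBt_bd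
        (hφcont.integrable_of_hasCompactSupport hφc)
    have i3 : Integrable (fun x => ⟪Dt x, φ x⟫) (volume : Measure E) :=
      integrable_inner_of_aestronglyMeasurable_of_norm_le hDt_meas hDt_bd
        (hφcont.integrable_of_hasCompactSupport hφc)
    have i4 : Integrable (fun x => ⟪u t x, φ x⟫) (volume : Measure E) :=
      integrable_inner_of_aestronglyMeasurable_of_norm_le (hsl t htI) (hbd t htI)
        (hφcont.integrable_of_hasCompactSupport hφc)
    have i12 : Integrable (fun x => ⟪h x, φ x⟫ - ⟪Bt x, φ x⟫) (volume : Measure E) := i1.sub i2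
    have i123 : Integrable (fun x => ⟪h x, φ x⟫ - ⟪Bt x, φ x⟫ + ⟪Dt x, φ x⟫) (volume : Measure E) :=
      i12.add i3
    have esplit : ∫ x, ⟪z x, φ x⟫ =
        (∫ x, ⟪h x, φ x⟫) - (∫ x, ⟪Bt x, φ x⟫) + (∫ x, ⟪Dt x, φ x⟫) - ∫ x, ⟪u t x, φ x⟫ := by
      simp only [hz, inner_sub_left, inner_add_left]
      rw [integral_sub i123 i4, integral_add i12 i3, integral_sub i1 i2]
    rw [esplit, e1, e2, e3, key]
    ring
  -- the annihilator lemma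
  obtain ⟨c, hc⟩ := hz_div.exists_ae_eq_const_of_norm_le_of_forall_integral_inner_eq_zero hz_meas hz_bd
    hz_orth
  refine ⟨c, ?_⟩
  filter_upwards [hc] with x hx
  simp only [hz] at hx
  rw [← hx]
  abel

/-- **The Oseen representation WITH A FORCE of bounded finite-energy duality-form mild solutions**
(Lemarié-Rieusset 2016, Thm. 6.1 with Prop. 6.5: very weak solutions in `L^∞((0,T), L²)` of the
forced system are Oseen solutions (6.12); Fabes–Jones–Rivière 1972, Thm. 2.1; Tao 2013, (9.2)).
Under the hypotheses of `exists_const_forced_oseenMild_of_bounded`, if moreover `E ≠ 0`, the slices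
of `u` on `[0, T]` are square integrable and the slices of the force on `(0, T)` are square
integrable with `‖g(τ)‖₂ ≤ G₂ < ∞`, then for every `t ∈ (0, T]`
`u(t) = e^{νtΔ}u(0) - B^ν_0(u,u)(t) + ∫₀ᵗ e^{ν(t-τ)Δ} g(τ) dτ` a.e. Proof: the constant `c` of the
(A1) step satisfies `c = e^{σΔ}(e^{νtΔ}u(0) - B^ν_0(u,u)(t) + D(t) - u(t))(0)` for every `σ > 0`, and
all four caloric extensions tend to `0` as `σ → ∞` (`L²` slices for `u(0)`, `u(t)` and `D(t)` —
the latter by Minkowski, `memLp_two_forceDuhamel`; `O(σ^{-1/2})` for the Duhamel term).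
[cite: LemarieRieusset2016, Thm. 6.1 with Prop. 6.5 (pp. 133–136)] [cite: FabesJonesRiviere1972, Thm. 2.1]
[cite: Tao2011, (9.2)] -/
theorem ae_eq_forced_oseenMild_of_bounded [Nontrivial E] (hν : 0 < ν) (hT : 0 < T)
    (hmild : IsMildNSSolutionOn (Ioc 0 T) ν g (u 0) u)
    (hmeas : AEStronglyMeasurable (uncurry u) ((volume : Measure (ℝ × E)).restrict (Ioo 0 T ×ˢ univ)))
    (hsl : ∀ t ∈ Icc 0 T, AEStronglyMeasurable (u t) volume) (hM : 0 < M)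
    (hbd : ∀ t ∈ Icc 0 T, ∀ y, ‖u t y‖ ≤ M) (hdiv0 : IsWeaklyDivFree (u 0))
    (h2 : ∀ t ∈ Icc 0 T, MemLp (u t) 2 volume)
    (hgm : StronglyMeasurable (uncurry g)) (hG : ∀ τ ∈ Ioo 0 T, ∀ y, ‖g τ y‖ ≤ G)
    (hgdiv : ∀ τ ∈ Ioo 0 T, IsWeaklyDivFree (g τ)) {G₂ : ℝ≥0∞} (hG₂ : G₂ ≠ ⊤)
    (hg2 : ∀ τ ∈ Ioo 0 T, MemLp (g τ) 2 volume ∧ eLpNorm (g τ) 2 volume ≤ G₂)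
    {t : ℝ} (ht : t ∈ Ioc 0 T) :
    u t =ᵐ[volume] fun x =>
      UnboundedOperators.heatExtension (u 0) (ν * t) x - oseenDuhamel ν 0 u u t x +
        forceDuhamel ν 0 g t x := by
  haveI : CompleteSpace E := FiniteDimensional.complete ℝ E
  have hE : 0 < Module.finrank ℝ E := Module.finrank_pos
  have h0I : (0 : ℝ) ∈ Icc 0 T := ⟨le_rfl, hT.le⟩
  have htI : t ∈ Icc 0 T := ⟨ht.1.le, ht.2⟩
  have hbd' : ∀ τ ∈ Ioo 0 T, ∀ y, ‖u τ y‖ ≤ M := fun τ hτ y => hbd τ ⟨hτ.1.le, hτ.2.le⟩ y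
  have hG' : ∀ τ ∈ Ioo 0 t, ∀ y, ‖g τ y‖ ≤ G := fun τ hτ y => hG τ ⟨hτ.1, hτ.2.trans_le ht.2⟩ y
  have hg2' : ∀ τ ∈ Ioo 0 t, MemLp (g τ) 2 volume ∧ eLpNorm (g τ) 2 volume ≤ G₂ := fun τ hτ =>
    hg2 τ ⟨hτ.1, hτ.2.trans_le ht.2⟩
  have hνt : 0 < ν * t := mul_pos hν ht.1
  obtain ⟨c, hc⟩ := exists_const_forced_oseenMild_of_bounded hν hT hmild hmeas hsl hM hbd hdiv0 hgm
    hG hgdiv ht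
  -- the four pieces and their classes
  set h : E → E := UnboundedOperators.heatExtension (u 0) (ν * t) with hh
  set Bt : E → E := oseenDuhamel ν 0 u u t with hBt
  set Dt : E → E := forceDuhamel ν 0 g t with hDt
  have hu0m : MemLp (u 0) ∞ (volume : Measure E) :=
    memLp_top_of_bound (hsl 0 h0I) M (Eventually.of_forall (hbd 0 h0I))
  have hh_cont : Continuous h :=
    (UnboundedOperators.contDiff_heatExtension_holds hu0m le_top hνt).continuous
  have hh_bd : ∀ x, ‖h x‖ ≤ M := fun x => UnboundedOperators.norm_heatExtension_le (hbd 0 h0I) hνt x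
  have hh_m : MemLp h ∞ (volume : Measure E) :=
    memLp_top_of_bound hh_cont.aestronglyMeasurable M (Eventually.of_forall hh_bd)
  have hh_2 : MemLp h 2 (volume : Measure E) :=
    UnboundedOperators.memLp_heatExtension_holds (h2 0 h0I) (by norm_num) hνt
  obtain ⟨CB, hCB, hCBle⟩ := exists_norm_oseenDuhamel_bounded_le (E := E)
  have hBt_bd : ∀ x, ‖Bt x‖ ≤ CB * M ^ 2 * ν ^ (-(1 / 2 : ℝ)) * (2 * Real.sqrt (t - 0)) := fun x =>
    hCBle hν ht.1 hM.le (fun τ hτ y => hbd' τ ⟨hτ.1, hτ.2.trans_le ht.2⟩ y)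
      (fun τ hτ y => hbd' τ ⟨hτ.1, hτ.2.trans_le ht.2⟩ y) x
  have hBt_meas : AEStronglyMeasurable Bt (volume : Measure E) :=
    aestronglyMeasurable_oseenDuhamel hν hmeas hmeas hM.le hbd' hbd' ht.1 ht.2
  have hBt_m : MemLp Bt ∞ (volume : Measure E) :=
    memLp_top_of_bound hBt_meas _ (Eventually.of_forall hBt_bd)
  have hDt_bd : ∀ x, ‖Dt x‖ ≤ (t - 0) * G := fun x => norm_forceDuhamel_le hν ht.1.le hG' x
  have hDt_meas : AEStronglyMeasurable Dt (volume : Measure E) :=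
    aestronglyMeasurable_forceDuhamel hgm ν 0 t
  have hDt_m : MemLp Dt ∞ (volume : Measure E) :=
    memLp_top_of_bound hDt_meas _ (Eventually.of_forall hDt_bd)
  have hDt_2 : MemLp Dt 2 (volume : Measure E) := memLp_two_forceDuhamel hν hgm hG₂ hg2'
  have hut_m : MemLp (u t) ∞ (volume : Measure E) :=
    memLp_top_of_bound (hsl t htI) M (Eventually.of_forall (hbd t htI))
  -- `z = h - Bt + Dt - u t = c` a.e.
  set z : E → E := h - Bt + Dt - u t with hz
  have hzc : z =ᵐ[volume] fun _ => c := by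
    filter_upwards [hc] with x hx
    simp only [hz, Pi.sub_apply, Pi.add_apply]
    rw [hx]
    simp only [hh, hBt, hDt]
    abel
  -- `e^{σΔ} z (0) = c` and `= e^{σΔ}h(0) - e^{σΔ}Bt(0) + e^{σΔ}Dt(0) - e^{σΔ}(u t)(0)`
  have hcσ : ∀ σ : ℝ, 0 < σ → c = UnboundedOperators.heatExtension h σ 0 -
      UnboundedOperators.heatExtension Bt σ 0 + UnboundedOperators.heatExtension Dt σ 0 -
        UnboundedOperators.heatExtension (u t) σ 0 := by
    intro σ hσ
    have e1 : UnboundedOperators.heatExtension z σ 0 = c := by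
      rw [heatExtension_congr_ae hzc σ, UnboundedOperators.heatExtension_const c hσ 0]
    have e2 : UnboundedOperators.heatExtension z σ =
        UnboundedOperators.heatExtension h σ - UnboundedOperators.heatExtension Bt σ +
          UnboundedOperators.heatExtension Dt σ - UnboundedOperators.heatExtension (u t) σ := by
      rw [hz, heatExtension_sub_eq_of_memLp ((hh_m.sub hBt_m).add hDt_m) hut_m le_top hσ,
        heatExtension_add_eq_of_memLp (hh_m.sub hBt_m) hDt_m le_top hσ,
        heatExtension_sub_eq_of_memLp hh_m hBt_m le_top hσ]
    rw [← e1, e2]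
    rfl
  -- a strongly measurable bounded representative of `u` on `(0, t) × E`, for the decay of `Bt`
  have hjm : AEStronglyMeasurable (uncurry u)
      ((volume : Measure (ℝ × E)).restrict (Ioo 0 t ×ˢ univ)) :=
    hmeas.mono_measure (Measure.restrict_mono (prod_mono (Ioo_subset_Ioo_right ht.2) Subset.rfl) le_rfl)
  obtain ⟨w, hwm, hwb, hwu⟩ := exists_stronglyMeasurable_representative hM hjm
    (fun τ hτ => Eventually.of_forall (hbd' τ ⟨hτ.1, hτ.2.trans_le ht.2⟩))
  have hBw : oseenDuhamel ν 0 w w t = Bt := funext fun x => oseenDuhamel_congr_ae_slices hwu x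
  obtain ⟨CD, hCD⟩ := exists_norm_heatExtension_oseenDuhamel_le hwm hM.le hwb hν ht.1
  rw [hBw] at hCD
  -- ### the four terms tend to zero as `σ → ∞`
  have lim_of_L2 : ∀ {k : E → E}, MemLp k 2 (volume : Measure E) →
      Tendsto (fun σ : ℝ => ‖UnboundedOperators.heatExtension k σ 0‖) atTop (𝓝 0) := by
    intro k hk
    have h1 := UnboundedOperators.tendsto_enorm_heatExtension_atTop hk (by norm_num)
      (by norm_num) hE (0 : E)
    have h2 := (ENNReal.tendsto_toReal ENNReal.zero_ne_top).comp h1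
    rw [ENNReal.toReal_zero] at h2
    exact h2.congr fun σ => by simp
  have lim_h := lim_of_L2 hh_2
  have lim_u := lim_of_L2 (h2 t htI)
  have lim_D := lim_of_L2 hDt_2
  have lim_B : Tendsto (fun σ : ℝ => ‖UnboundedOperators.heatExtension Bt σ 0‖) atTop (𝓝 0) := by
    have h1 : Tendsto (fun σ : ℝ => CD * σ ^ (-(1 / 2 : ℝ))) atTop (𝓝 0) := by
      have := (tendsto_rpow_neg_atTop (y := 1 / 2) (by norm_num)).const_mul CD
      simpa using this
    refine squeeze_zero' (Eventually.of_forall fun σ => norm_nonneg _) ?_ h1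
    filter_upwards [eventually_gt_atTop 0] with σ hσ
    exact hCD hσ 0
  -- hence `c = 0`
  have hc0 : c = 0 := by
    have hlim : Tendsto (fun σ : ℝ => ‖UnboundedOperators.heatExtension h σ 0‖ +
        ‖UnboundedOperators.heatExtension Bt σ 0‖ + ‖UnboundedOperators.heatExtension Dt σ 0‖ +
          ‖UnboundedOperators.heatExtension (u t) σ 0‖) atTop (𝓝 0) := by
      simpa using ((lim_h.add lim_B).add lim_D).add lim_u
    have hle : ∀ᶠ σ : ℝ in atTop, ‖c‖ ≤ ‖UnboundedOperators.heatExtension h σ 0‖ +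
        ‖UnboundedOperators.heatExtension Bt σ 0‖ + ‖UnboundedOperators.heatExtension Dt σ 0‖ +
          ‖UnboundedOperators.heatExtension (u t) σ 0‖ := by
      filter_upwards [eventually_gt_atTop 0] with σ hσ
      rw [hcσ σ hσ]
      have := norm_sub_le (UnboundedOperators.heatExtension h σ 0 - UnboundedOperators.heatExtension Bt σ 0
        + UnboundedOperators.heatExtension Dt σ 0) (UnboundedOperators.heatExtension (u t) σ 0)
      have h' := norm_add_le (UnboundedOperators.heatExtension h σ 0 - UnboundedOperators.heatExtension Bt σ 0)
        (UnboundedOperators.heatExtension Dt σ 0)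
      have h'' := norm_sub_le (UnboundedOperators.heatExtension h σ 0) (UnboundedOperators.heatExtension Bt σ 0)
      linarith
    have h0 : ‖c‖ ≤ 0 := ge_of_tendsto hlim hle
    exact norm_le_zero_iff.1 h0
  -- conclusion
  filter_upwards [hc] with x hx
  rw [hx, hc0, sub_zero]

end Representation

/-! ### From Leray–Hopf: forced Leray–Hopf solutions are duality-form mild solutions -/

section LerayHopf

variable {T ν : ℝ} {f : ℝ → E → E} {u₀ : E → E} {u : ℝ → E → E}

/-- **Leray–Hopf solutions of the forced system are mild solutions on `(0, T]`** in the accepted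
duality form (forced twin of `IsLerayHopfOn.isMildNSSolutionOn_Ioc`; Fabes–Jones–Rivière 1972,
Thm. 2.1 (i) ⇒ (ii) with force; Lemarié-Rieusset 2016, Prop. 6.5 with Thm. 6.1): `dim E = 3`,
`0 < ν`, `0 < T`, `u₀ ∈ L²`, `f ∈ L²((0,T) × E)` jointly a.e.-strongly measurable, slices
`‖u(s)‖₂ ≤ M < ∞` on `[0, T]`. A repackaging of `IsLerayHopfOn.integral_inner_eq_mild_forced`.
[cite: FabesJonesRiviere1972, Thm. 2.1] [cite: LemarieRieusset2016, Prop. 6.5 and Thm. 6.1] -/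
theorem IsLerayHopfOn.isMildNSSolutionOn_Ioc_forced (hE3 : Module.finrank ℝ E = 3)
    (hu : IsLerayHopfOn T ν f u₀ u) (hu₀ : MemLp u₀ 2 volume) (hν : 0 < ν) (hT : 0 < T)
    (hfm : AEStronglyMeasurable (uncurry f) ((volume.restrict (Ioo 0 T)).prod (volume : Measure E)))
    (hf2 : eLpNorm (uncurry f) 2 ((volume.restrict (Ioo 0 T)).prod (volume : Measure E)) < ⊤)
    {M : ℝ≥0∞} (hMtop : M ≠ ⊤) (hM : ∀ s ∈ Icc 0 T, eLpNorm (u s) 2 volume ≤ M) :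
    IsMildNSSolutionOn (Ioc 0 T) ν f u₀ u := by
  refine ⟨fun t ht => hu.isWeaklyDivFree_slice ht, fun t ht φ hφ hdiv => ?_⟩
  rw [intervalIntegral.integral_of_le ht.1.le, intervalIntegral.integral_of_le ht.1.le,
    hu.integral_inner_eq_mild_forced hE3 hu₀ hν hT hfm hf2 hMtop hM hφ hdiv ht]

end LerayHopf

end Literature.Analysis.FluidPDE

end
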